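import Literature.Analysis.FluidPDE.Tao2016AveragedNS.SelfSimilarCascadeBlowup
import Literature.Analysis.ODE.LinearComparison
import Literature.Barriers.NavierStokesRegularity.DyadicCascadePositivity
import Literature.Barriers.NavierStokesRegularity.DyadicSmoothing
import Literature.Barriers.NavierStokesRegularity.DyadicCascadeSmoothing
import Literature.Barriers.NavierStokesRegularity.DyadicCascadeRegularityBMRProofs

/-!
# The viscous dyadic member of Tao's comparable class at `ε₀ = 1` is globally regular
# (Barbato–Morandin–Romito 2011, Thm. 1, transported to the cascade lattice)

Sources.  D. Barbato, F. Morandin, M. Romito, *Smooth solutions for the dyadic model*,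
Nonlinearity **24** (2011) 3083–3097 [`BarbatoMorandinRomito2011`]: §1.1 (the model (1.1) and
Theorem 1), §3 (Def. 3.1, positivity from [Che08]), §3.1 Prop. 3.3 and §3.2 (proof of Theorem 1:
the invariant region at a good time and the smoothing bootstrap).  T. Tao, *Finite time blowup for
an averaged three-dimensional Navier–Stokes equation*, J. Amer. Math. Soc. **29** (2016) 601–674 =
arXiv:1402.0290v3 [`Tao2016AveragedNS`]: §1.2 p. 9 ("for the values `λ = 2^{1/α}`, `α = 2/5`,
global regularity was established in [bmr] (for non-negative initial data)"), §4 Lemma 4.1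
(4.5)–(4.11) and the viscous equation before Theorem 4.2 ("the viscous equation generalises the
dyadic Katz–Pavlovic equation … with `λ = (1+ε₀)^{5/2}` and `α = 2/5` … `m = 1`").
A. Cheskidov, *Blow-up in finite time for the dyadic model of the Navier–Stokes equations*,
Trans. AMS **360** (2008) [`Cheskidov2008`]: §4 Thm. 4.2 (positivity).

This is the COMPANION of the lemma layer `SelfSimilarCascadeBlowup` (requested by cell
harvest/h2-tao-ladder, planner theory-2 g7, as sections `BMROneMode` and `ViscousDyadic` of its
kernel-checked source `SelfSimilarCascadeBlowup.lean` sha16 7bf15a90977ab144; split off here so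
that the lemma layer imports only `RenormalisedCascadeWaves`).  MODEL lattice ODEs only; NOTHING
here is a statement about the Navier–Stokes equations.

* **BMR 2011 at `β = 5/2`: uniform weighted bounds from a one-mode datum.**  Auxiliary estimates
  on a BMR weak solution (`Literature.Barriers.NavierStokesRegularity.Dyadic.IsBMRWeakSolution`,
  a structure of the barrier catalogue in ANOTHER directory, so the four statements about it are
  declared with their absolute names as dot-notation extensions, CONVENTIONS §2):
  `IsBMRWeakSolution.contDiffOn_one` (modes are `C¹` on `[0,∞)`),
  `IsBMRWeakSolution.bootstrap_uniform` (the invariant-region bound at the good time `t₀ = 0`,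
  `rpow_mul_le_of_goodTime`, iterated through ten `decay_step`s with exponents
  `bootExp k = 1/2 + 2^k/100`, `bootExp 10 ≥ 10`), `IsBMRWeakSolution.smallTime_bound` (an
  elementary induction over the modes near `t = 0` from a one-mode datum, via positivity and
  `Literature.Analysis.ODE.le_linearComparison`), `IsBMRWeakSolution.weight_bound_oneMode`
  (uniform bounds `X_m ≤ M`, `2^{10m} X_m ≤ M` on `[0,T]`).  They use only theorems already in
  the tree (`DyadicCascadePositivity`, `DyadicSmoothing`, `DyadicCascadeSmoothing`,
  `DyadicCascadeRegularityBMRProofs`).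
* **The viscous dyadic member at `ε₀ = 1` is globally regular** (Barbato–Morandin–Romito 2011,
  Thm. 1, PROVED in the tree as `BarbatoMorandinRomito2011_thm1_holds`): at `ε₀ = 1` the lattice
  of `dyadicTable` on component `0` with dissipation `ν·4ⁿ` is BMR's model (1.1) at `β = 5/2`,
  `λ = 2` under `X_{0,n} = 2^{5/2} Y_{n+1}`, viscosity `ν/4` (`viscousGlobal_bmrEmbed`; auxiliary
  data `bmrScale = 2^{5/2}`, `bmrDatum`, `bmrEmbed`); the uniform a-priori weight
  `(1 + 2^{10n})|X_{0,n}|` of (4.5) on `[0,T]` comes from `IsBMRWeakSolution.weight_bound_oneMode`;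
  hence for every `ν > 0` and every one-shell datum on component `0` with `X₀ 0 ≥ 0` a global
  regular viscous solution exists (`exists_viscousGlobal_one_dyadicTable`),
  `HasGlobal 1 dyadicTable κ κ 0 X₀` for every `κ > 0` (`hasGlobal_one_dyadicTable`, via
  `hasGlobal_of_viscousGlobal` with `ν = κ/√2` and `hasGlobal_mono`), and Theorem 4.2-level
  blow-up FAILS for the dyadic member at `ε₀ = 1` (`not_noGlobalCascade_one_dyadicTable`, via the
  κ-normal form `noGlobalCascade_iff_kappa`) — the formal content of Tao's remark that [bmr] rules
  out the dyadic analogue of his Theorem 1.5 [Tao2016AveragedNS, §1.2 p. 9].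

SCOPE (honest): `ε₀ = 1` only — BMR's `λ = 2`, `β = 5/2` is Tao's base `1+ε₀ = 2`, and the tree's
`IsBMRWeakSolution` fixes `λₙ = 2ⁿ` (`bmrLambda`); nothing is said about small `ε₀` (the regime of
the rung-2 predicates `NoRobustBlowupBelow R` etc.) or about other tables.  No instances, no
notation; no named facts.  Docstrings mark cell vocabulary as such.
-/

noncomputable section

open Set MeasureTheory intervalIntegral Filter Topology

namespace Literature.Analysis.FluidPDE

namespace TaoCascade

/-! ## BMR 2011 at `β = 5/2`: uniform weighted bounds from a one-mode datum

Auxiliary estimates for the viscous dyadic member (next section), in this file's path namespace;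
the four statements about a BMR weak solution are dot-notation extensions of the barrier
catalogue's structure `Literature.Barriers.NavierStokesRegularity.Dyadic.IsBMRWeakSolution`
(another directory), hence declared with their absolute names (CONVENTIONS §2).  They use only
theorems already in the tree (`DyadicCascadePositivity`, `DyadicSmoothing`,
`DyadicCascadeSmoothing`, `DyadicCascadeRegularityBMRProofs`). -/

section BMROneMode

open Literature.Barriers.NavierStokesRegularity.Dyadic

variable {ν : ℝ} {x : ℕ → ℝ} {X : ℕ → ℝ → ℝ}

/-- The exponents of the BMR smoothing bootstrap at `β = 5/2`: `q_k = 1/2 + 2^k/100`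
(`q_{k+1} = 2q_k + 2 - β`, `q₀ = β - 2 + ε`, `ε = 1/100`).
[cite: BarbatoMorandinRomito2011, §3.2 (proof of Thm. 1) and §3.1 Prop. 3.3] -/
def bootExp (k : ℕ) : ℝ := 1 / 2 + (2 : ℝ) ^ k / 100

/-- [cite: BarbatoMorandinRomito2011, §3.2] -/
theorem bootExp_zero : (5 / 2 : ℝ) - 2 + 1 / 100 = bootExp 0 := by norm_num [bootExp]

/-- [cite: BarbatoMorandinRomito2011, §3.2] -/
theorem bootExp_succ (k : ℕ) : 2 * bootExp k + 2 - 5 / 2 = bootExp (k + 1) := by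
  simp only [bootExp, pow_succ]; ring

/-- [cite: BarbatoMorandinRomito2011, §3.2] -/
theorem ten_le_bootExp_ten : (10 : ℝ) ≤ bootExp 10 := by norm_num [bootExp]

/-- `C¹` on `[0,∞)` from a right derivative that is continuous on `[0,∞)` (private helper). [folklore] -/
private theorem contDiffOn_one_Ici_of_hasDerivWithinAt {f f' : ℝ → ℝ}
    (hf : ∀ t, 0 ≤ t → HasDerivWithinAt f (f' t) (Ici 0) t) (hf' : ContinuousOn f' (Ici 0)) :
    ContDiffOn ℝ 1 f (Ici 0) := by
  rw [show (1 : WithTop ℕ∞) = 0 + 1 from (zero_add 1).symm,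
    contDiffOn_succ_iff_derivWithin (uniqueDiffOn_Ici 0)]
  refine ⟨fun t ht => (hf t ht).differentiableWithinAt, fun h => absurd h (by simp), ?_⟩
  exact contDiffOn_zero.2
    (hf'.congr fun t ht => (hf t ht).derivWithin (uniqueDiffOn_Ici 0 t ht))

/-- Every mode `m ≥ 1` of a BMR weak solution is `C¹` on `[0, ∞)` (the right-hand side is
continuous). [cite: BarbatoMorandinRomito2011, §3 Def. 3.1] -/
theorem _root_.Literature.Barriers.NavierStokesRegularity.Dyadic.IsBMRWeakSolution.contDiffOn_one
    {β : ℝ} (hX : IsBMRWeakSolution ν β x X) (hβ : β ≠ 0)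
    (m : ℕ) : ContDiffOn ℝ 1 (X (m + 1)) (Ici 0) :=
  contDiffOn_one_Ici_of_hasDerivWithinAt (fun t ht => hX.2 (m + 1) (by omega) t ht)
    (hX.continuousOn_rhs hβ m)

/-- **Uniform smoothing bootstrap from the good time `t₀ = 0`** (`β = 5/2`, `λ = 2`, `ν > 0`,
non-negative `ℓ²` datum): if `λₙ^{β-2+ε} Xₙ(0) ≤ K` for all `n ≥ 1` (`K > 0`, `ε = 1/100`), then
after `k` steps of width `d > 0` the weight `λₙ^{q_k} Xₙ(t)` is bounded uniformly in `n ≥ 1` and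
`t ≥ k d` — the invariant-region bound (`rpow_mul_le_of_goodTime`) iterated through `decay_step`.
[cite: BarbatoMorandinRomito2011, §3.2 (proof of Thm. 1, both claims) and §3.1 Prop. 3.3] -/
theorem _root_.Literature.Barriers.NavierStokesRegularity.Dyadic.IsBMRWeakSolution.bootstrap_uniform
    (hX : IsBMRWeakSolution ν (5 / 2) x X) (hν : 0 < ν)
    (hx : ∀ n, 1 ≤ n → 0 ≤ x n) (hx2 : Summable fun n => x n ^ 2) {K d : ℝ} (hK : 0 < K)
    (hd : 0 < d) (hbd : ∀ n, 1 ≤ n → bmrLambda n ^ ((5 / 2 : ℝ) - 2 + 1 / 100) * X n 0 ≤ K)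
    (k : ℕ) :
    ∃ Kk : ℝ, ∀ n, 1 ≤ n → ∀ t, (k : ℝ) * d ≤ t → bmrLambda n ^ bootExp k * X n t ≤ Kk := by
  induction k with
  | zero =>
    refine ⟨10 * K, fun n hn t ht => ?_⟩
    have h0 : ∀ n, 1 ≤ n → bmrLambda n ^ ((5 / 2 : ℝ) - 2 + 1 / 100) * X n 0 ≤ K := hbd
    have h := hX.rpow_mul_le_of_goodTime hν (by norm_num) le_rfl (by norm_num : (0 : ℝ) < 1 / 100)
      le_rfl rfl hx hx2 le_rfl hK h0 n hn t (by simpa using ht)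
    rwa [bootExp_zero] at h
  | succ k ih =>
    obtain ⟨Kk, hKk⟩ := ih
    have hs0 : (0 : ℝ) ≤ (k : ℝ) * d := by positivity
    have hs : (k : ℝ) * d < ((k + 1 : ℕ) : ℝ) * d := by push_cast; nlinarith
    obtain ⟨K', hK'⟩ := hX.decay_step hν (by norm_num) hx hx2 hs0 hs hKk
    refine ⟨K', fun n hn t ht => ?_⟩
    have h := hK' n hn t ht
    rwa [bootExp_succ] at h

/-- **Small times from a one-mode datum** (`β = 5/2`, `ν ≥ 0`): if `x₂ = x₃ = … = 0`,
`2^{10} x₁ ≤ K` and `δ K ≤ 1/8`, then `2^{10 m} X_m(t) ≤ K` for all `m ≥ 1`, `t ∈ [0, δ]` — induction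
over the modes: `X₁` only decays (`mode_one_le`), and by positivity
`Ẋ_{m+1} ≤ λ_m^{5/2} X_m² ≤ 2^{3m}(K 2^{-10m})²`, `X_{m+1}(0) = 0` (linear comparison).
[cite: BarbatoMorandinRomito2011, §1.1 (1.1) and §3 (positivity, from [Che08])] [cite: Cheskidov2008, §4 Thm. 4.2] -/
theorem _root_.Literature.Barriers.NavierStokesRegularity.Dyadic.IsBMRWeakSolution.smallTime_bound
    (hX : IsBMRWeakSolution ν (5 / 2) x X) (hν : 0 ≤ ν)
    (hx : ∀ n, 1 ≤ n → 0 ≤ x n) (hx0 : ∀ n, 2 ≤ n → x n = 0) {K δ : ℝ} (hK : 0 ≤ K)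
    (hK1 : (2 : ℝ) ^ 10 * x 1 ≤ K) (hδ : 0 < δ) (hδK : δ * K ≤ 1 / 8) :
    ∀ j : ℕ, ∀ t ∈ Icc 0 δ, (2 : ℝ) ^ (10 * (j + 1)) * X (j + 1) t ≤ K := by
  have hβ : (5 / 2 : ℝ) ≠ 0 := by norm_num
  have hpos := hX.nonneg hβ hx
  intro j
  induction j with
  | zero =>
    intro t ht
    have h1 := hX.mode_one_le hβ hν hpos ht.1
    rw [hX.1 1 le_rfl] at h1
    have hX1t := hpos 1 le_rfl t ht.1
    have he : 1 ≤ Real.exp (ν * bmrLambda 1 * t) :=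
      Real.one_le_exp (mul_nonneg (mul_nonneg hν (bmrLambda_nonneg 1)) ht.1)
    have hX1 : X 1 t ≤ x 1 := by nlinarith
    have : (2 : ℝ) ^ 10 * X 1 t ≤ K := (mul_le_mul_of_nonneg_left hX1 (by positivity)).trans hK1
    simpa using this
  | succ j ih =>
    intro t ht
    show (2 : ℝ) ^ (10 * (j + 2)) * X (j + 2) t ≤ K
    set c : ℝ := K / (2 : ℝ) ^ (10 * (j + 1)) with hc
    have hc0 : 0 ≤ c := by positivity
    have hprev : ∀ r ∈ Icc 0 δ, X (j + 1) r ≤ c := fun r hr => by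
      rw [hc, le_div_iff₀ (by positivity), mul_comm]; exact ih r hr
    set C : ℝ := bmrLambda (j + 1) ^ ((5 / 2 : ℝ)) * c ^ 2 with hC
    have hL1 : 0 ≤ bmrLambda (j + 1) ^ (5 / 2 : ℝ) := Real.rpow_nonneg (bmrLambda_nonneg _) _
    have hC0 : 0 ≤ C := mul_nonneg hL1 (sq_nonneg _)
    have hg : ContinuousOn (X (j + 2)) (Icc 0 δ) :=
      (hX.continuousOn (by omega)).mono Icc_subset_Ici_self
    have hg' : ∀ r ∈ Ico 0 δ, HasDerivWithinAt (X (j + 2))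
        (bmrRHS ν (5 / 2) (fun k => X k r) (j + 2)) (Ici r) r := fun r hr =>
      (hX.2 (j + 2) (by omega) r hr.1).mono (Ici_subset_Ici.2 hr.1)
    have hbound : ∀ r ∈ Ico 0 δ,
        bmrRHS ν (5 / 2) (fun k => X k r) (j + 2) ≤ C + 0 * X (j + 2) r := by
      intro r hr
      simp only [show j + 2 = j + 1 + 1 from rfl, bmrRHS_succ]
      have h1 := hpos (j + 1) (by omega) r hr.1
      have h2 := hpos (j + 1 + 1) (by omega) r hr.1
      have h3 := hpos (j + 1 + 2) (by omega) r hr.1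
      have hL2 : 0 ≤ bmrLambda (j + 1 + 1) ^ (5 / 2 : ℝ) := Real.rpow_nonneg (bmrLambda_nonneg _) _
      have hsq : X (j + 1) r ^ 2 ≤ c ^ 2 :=
        pow_le_pow_left₀ h1 (hprev r (Ico_subset_Icc_self hr)) 2
      have hA : bmrLambda (j + 1) ^ (5 / 2 : ℝ) * X (j + 1) r ^ 2 ≤ C :=
        mul_le_mul_of_nonneg_left hsq hL1
      have hB : 0 ≤ ν * bmrLambda (j + 1 + 1) ^ 2 * X (j + 1 + 1) r :=
        mul_nonneg (mul_nonneg hν (sq_nonneg _)) h2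
      have hD : 0 ≤ bmrLambda (j + 1 + 1) ^ (5 / 2 : ℝ) * X (j + 1 + 1) r * X (j + 1 + 2) r :=
        mul_nonneg (mul_nonneg hL2 h2) h3
      linarith
    have key := Literature.Analysis.ODE.le_linearComparison hg hg' continuousOn_const
      continuousOn_const hbound ht
    simp only [intervalIntegral.integral_zero, Real.exp_zero, neg_zero, mul_one, one_mul,
      intervalIntegral.integral_const, smul_eq_mul, sub_zero] at key
    have h0 : X (j + 2) 0 = 0 := by
      rw [hX.1 (j + 2) (by omega)]; exact hx0 (j + 2) (by omega)
    rw [h0, zero_add] at key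
    have hlam : bmrLambda (j + 1) ^ (5 / 2 : ℝ) ≤ (2 : ℝ) ^ (3 * (j + 1)) := by
      rw [bmrLambda_of_ne_zero (by omega : j + 1 ≠ 0)]
      calc ((2 : ℝ) ^ (j + 1)) ^ (5 / 2 : ℝ) ≤ ((2 : ℝ) ^ (j + 1)) ^ ((3 : ℕ) : ℝ) :=
            Real.rpow_le_rpow_of_exponent_le (one_le_pow₀ (by norm_num)) (by norm_num)
        _ = (2 : ℝ) ^ (3 * (j + 1)) := by rw [Real.rpow_natCast, ← pow_mul, mul_comm]
    have htC : t * C ≤ δ * C := mul_le_mul_of_nonneg_right ht.2 hC0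
    have hCle : C ≤ (2 : ℝ) ^ (3 * (j + 1)) * c ^ 2 := mul_le_mul_of_nonneg_right hlam (sq_nonneg _)
    have hQ : (2 : ℝ) ^ (10 * (j + 2)) * (2 : ℝ) ^ (3 * (j + 1)) ≤
        8 * ((2 : ℝ) ^ (10 * (j + 1)) * (2 : ℝ) ^ (10 * (j + 1))) := by
      rw [← pow_add, ← pow_add, show (8 : ℝ) = 2 ^ 3 by norm_num, ← pow_add]
      exact pow_le_pow_right₀ (by norm_num) (by omega)
    calc (2 : ℝ) ^ (10 * (j + 2)) * X (j + 2) t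
        ≤ (2 : ℝ) ^ (10 * (j + 2)) * (δ * ((2 : ℝ) ^ (3 * (j + 1)) * c ^ 2)) := by
          apply mul_le_mul_of_nonneg_left _ (by positivity)
          exact key.trans (htC.trans (mul_le_mul_of_nonneg_left hCle hδ.le))
      _ = (δ * K) * K * ((2 : ℝ) ^ (10 * (j + 2)) * (2 : ℝ) ^ (3 * (j + 1)) /
            ((2 : ℝ) ^ (10 * (j + 1)) * (2 : ℝ) ^ (10 * (j + 1)))) := by
          rw [hc]; field_simp
      _ ≤ (1 / 8 * K) * 8 := by
          apply mul_le_mul (mul_le_mul_of_nonneg_right hδK hK) _ (by positivity) (by positivity)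
          rwa [div_le_iff₀ (by positivity)]
      _ = K := by ring

/-- **Uniform weighted bounds on `[0, T]` from a one-mode datum** (`β = 5/2`, `λ = 2`, `ν > 0`,
`x₁ ≥ 0`, `x₂ = x₃ = … = 0`): `X_m(t) ≤ M` and `2^{10 m} X_m(t) ≤ M` for all `m ≥ 1`, `t ∈ [0, T]`
(`smallTime_bound` on `[0, δ]`, `bootstrap_uniform` with ten steps on `[δ, ∞)`).
[cite: BarbatoMorandinRomito2011, §1.1 Thm. 1 and §3.2] -/
theorem _root_.Literature.Barriers.NavierStokesRegularity.Dyadic.IsBMRWeakSolution.weight_bound_oneMode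
    (hX : IsBMRWeakSolution ν (5 / 2) x X) (hν : 0 < ν)
    (hx1 : 0 ≤ x 1) (hx0 : ∀ n, 2 ≤ n → x n = 0) (hx2 : Summable fun n => x n ^ 2) (T : ℝ) :
    ∃ M : ℝ, 0 ≤ M ∧ ∀ t ∈ Icc 0 T, ∀ m, 1 ≤ m →
      X m t ≤ M ∧ (2 : ℝ) ^ (10 * m) * X m t ≤ M := by
  have hβ : (5 / 2 : ℝ) ≠ 0 := by norm_num
  have hx : ∀ n, 1 ≤ n → 0 ≤ x n := by
    intro n hn
    rcases Nat.lt_or_ge n 2 with h | h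
    · obtain rfl : n = 1 := by omega
      exact hx1
    · rw [hx0 n h]
  have hpos := hX.nonneg hβ hx
  -- small times
  set Ks : ℝ := (2 : ℝ) ^ 10 * x 1 + 1 with hKs
  have hKs0 : 0 < Ks := by positivity
  set δ : ℝ := 1 / (8 * Ks) with hδ
  have hδ0 : 0 < δ := by positivity
  have hδK : δ * Ks ≤ 1 / 8 := by rw [hδ]; field_simp; rfl
  have hsmall := hX.smallTime_bound hν.le hx hx0 hKs0.le (by linarith) hδ0 hδK
  -- large times: bootstrap with d = δ/10, k = 10
  set K0 : ℝ := 2 * x 1 + 1 with hK0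
  have hK00 : 0 < K0 := by positivity
  have hbd : ∀ n, 1 ≤ n → bmrLambda n ^ ((5 / 2 : ℝ) - 2 + 1 / 100) * X n 0 ≤ K0 := by
    intro n hn
    rw [hX.1 n hn]
    rcases Nat.lt_or_ge n 2 with h | h
    · obtain rfl : n = 1 := by omega
      have hL : bmrLambda 1 = 2 := by rw [bmrLambda_of_ne_zero one_ne_zero, pow_one]
      rw [hL]
      have h2 : (2 : ℝ) ^ ((5 / 2 : ℝ) - 2 + 1 / 100) ≤ 2 := by
        calc (2 : ℝ) ^ ((5 / 2 : ℝ) - 2 + 1 / 100) ≤ (2 : ℝ) ^ (1 : ℝ) :=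
              Real.rpow_le_rpow_of_exponent_le (by norm_num) (by norm_num)
          _ = 2 := Real.rpow_one 2
      nlinarith [Real.rpow_nonneg (by norm_num : (0 : ℝ) ≤ 2) ((5 / 2 : ℝ) - 2 + 1 / 100)]
    · rw [hx0 n h, mul_zero]; positivity
  obtain ⟨K10, hK10⟩ := hX.bootstrap_uniform hν hx hx2 hK00 (by positivity : (0 : ℝ) < δ / 10)
    hbd 10
  refine ⟨max (max Ks K10) 0, le_max_right _ _, fun t ht m hm => ?_⟩
  have hXm := hpos m hm t ht.1
  have h2m : (1 : ℝ) ≤ (2 : ℝ) ^ (10 * m) := one_le_pow₀ (by norm_num)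
  -- it suffices to bound the weighted quantity
  suffices hw : (2 : ℝ) ^ (10 * m) * X m t ≤ max (max Ks K10) 0 from
    ⟨(le_mul_of_one_le_left hXm h2m).trans hw, hw⟩
  rcases le_or_gt t δ with htδ | htδ
  · obtain ⟨j, rfl⟩ : ∃ j, m = j + 1 := ⟨m - 1, by omega⟩
    exact (hsmall j t ⟨ht.1, htδ⟩).trans ((le_max_left _ _).trans (le_max_left _ _))
  · have ht' : ((10 : ℕ) : ℝ) * (δ / 10) ≤ t := by push_cast; linarith
    have hb := hK10 m hm t ht'
    have hm0 : m ≠ 0 := by omega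
    have hL1 : (1 : ℝ) ≤ bmrLambda m := by
      rw [bmrLambda_of_ne_zero hm0]; exact one_le_pow₀ (by norm_num)
    have hpow : (2 : ℝ) ^ (10 * m) = bmrLambda m ^ ((10 : ℕ) : ℝ) := by
      rw [bmrLambda_of_ne_zero hm0, Real.rpow_natCast, ← pow_mul, mul_comm]
    have hle : (2 : ℝ) ^ (10 * m) ≤ bmrLambda m ^ bootExp 10 := by
      rw [hpow]
      exact Real.rpow_le_rpow_of_exponent_le hL1 (by exact_mod_cast ten_le_bootExp_ten)
    calc (2 : ℝ) ^ (10 * m) * X m t ≤ bmrLambda m ^ bootExp 10 * X m t :=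
          mul_le_mul_of_nonneg_right hle hXm
      _ ≤ K10 := hb
      _ ≤ max (max Ks K10) 0 := (le_max_right _ _).trans (le_max_left _ _)

end BMROneMode

/-! ## The viscous dyadic member at `ε₀ = 1` is globally regular (Barbato–Morandin–Romito 2011)

At `ε₀ = 1` the per-shell gain of `dyadicTable` is `2^{5/2}` and the NS dissipation is `ν 4ⁿ`:
under `X_{0,n}(t) = 2^{5/2} Y_{n+1}(t)` (`n ≥ 0`) the component-`0` lattice is BMR's model (1.1)
with `λ = 2`, `β = 5/2`, viscosity `ν/4`, and the one-shell datum `X₀ 0` at shell `0` is the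
one-mode datum `x₁ = 2^{-5/2} X₀ 0`.  BMR's Theorem 1 (PROVED in the tree) then supplies a global
regular viscous solution, uniformly weighted as (4.5) demands by the previous section. -/

section ViscousDyadic

open Literature.Barriers.NavierStokesRegularity.Dyadic


/-- The amplitude scale `2^{5/2}` between BMR's modes and the lattice at `ε₀ = 1`.
[cite: BarbatoMorandinRomito2011, §1.1 (1.1)] [cite: Tao2016AveragedNS, §1.2 p. 9] -/
def bmrScale : ℝ := (2 : ℝ) ^ ((5 : ℝ) / 2)

/-- [cite: BarbatoMorandinRomito2011, §1.1 (1.1)] -/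
theorem bmrScale_pos : 0 < bmrScale := Real.rpow_pos_of_pos two_pos _

/-- `2^{5/2}·2^{5/2} = 32` (private helper). [folklore] -/
private theorem bmrScale_sq : bmrScale * bmrScale = 32 := by
  rw [bmrScale, ← Real.rpow_add two_pos]; norm_num

/-- `(2^k)^r = 2^{k r}` (private helper). [folklore] -/
private theorem two_pow_rpow (k : ℕ) (r : ℝ) : ((2 : ℝ) ^ k) ^ r = (2 : ℝ) ^ ((k : ℝ) * r) := by
  rw [← Real.rpow_natCast, ← Real.rpow_mul (by norm_num : (0 : ℝ) ≤ 2)]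

/-- The BMR datum of the one-shell lattice datum `a` at shell `0`: `x₁ = a / 2^{5/2}`, all other
modes `0`. [cite: BarbatoMorandinRomito2011, §1.1 (1.1)] [cite: Tao2016AveragedNS, §4 Lemma 4.1 (4.7)] -/
def bmrDatum (a : ℝ) : ℕ → ℝ := fun n => if n = 1 then a / bmrScale else 0

/-- [cite: BarbatoMorandinRomito2011, §1.1 (1.1)] -/
theorem bmrDatum_one (a : ℝ) : bmrDatum a 1 = a / bmrScale := by simp [bmrDatum]

/-- [cite: BarbatoMorandinRomito2011, §1.1 (1.1)] -/
theorem bmrDatum_of_two_le (a : ℝ) {n : ℕ} (hn : 2 ≤ n) : bmrDatum a n = 0 := by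
  simp [bmrDatum, show n ≠ 1 by omega]

/-- [cite: BarbatoMorandinRomito2011, §1.1 Thm. 1 (hypothesis `xₙ ≥ 0`)] -/
theorem bmrDatum_nonneg {a : ℝ} (ha : 0 ≤ a) (n : ℕ) : 0 ≤ bmrDatum a n := by
  unfold bmrDatum; split_ifs
  · exact div_nonneg ha bmrScale_pos.le
  · exact le_rfl

/-- [cite: BarbatoMorandinRomito2011, §1.1 Thm. 1 (hypothesis `∑ xₙ² < ∞`)] -/
theorem summable_bmrDatum_sq (a : ℝ) : Summable fun n => bmrDatum a n ^ 2 := by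
  apply summable_of_ne_finset_zero (s := {1})
  intro n hn
  rw [Finset.mem_singleton] at hn
  simp [bmrDatum, hn]

/-- **The embedding** of a BMR mode family into the `m = 4` lattice: component `0`, shell
`n ≥ 0 ↦ 2^{5/2} Y_{n+1}`; all other components and all negative shells `0`.
[cite: Tao2016AveragedNS, §1.2 p. 9 (the dyadic model inside the averaged equation)] [cite: BarbatoMorandinRomito2011, §1.1 (1.1)] -/
def bmrEmbed (Y : ℕ → ℝ → ℝ) : Fin 4 → ℤ → ℝ → ℝ := fun i n t =>
  if i = 0 ∧ 0 ≤ n then bmrScale * Y (n.toNat + 1) t else 0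

/-- [cite: BarbatoMorandinRomito2011, §1.1 (1.1)] -/
@[simp] theorem bmrEmbed_zero_natCast (Y : ℕ → ℝ → ℝ) (k : ℕ) (t : ℝ) :
    bmrEmbed Y 0 (k : ℤ) t = bmrScale * Y (k + 1) t := by
  simp [bmrEmbed]

/-- [cite: BarbatoMorandinRomito2011, §1.1 (1.1)] -/
theorem bmrEmbed_zero_natCast_eq (Y : ℕ → ℝ → ℝ) (k : ℕ) :
    bmrEmbed Y 0 (k : ℤ) = fun t => bmrScale * Y (k + 1) t :=
  funext fun t => bmrEmbed_zero_natCast Y k t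

/-- [cite: Tao2016AveragedNS, §1.2 p. 9] -/
theorem bmrEmbed_of_ne (Y : ℕ → ℝ → ℝ) {i : Fin 4} (hi : i ≠ 0) (n : ℤ) (t : ℝ) :
    bmrEmbed Y i n t = 0 := by
  simp [bmrEmbed, hi]

/-- [cite: Tao2016AveragedNS, §4 Lemma 4.1 (4.11)] -/
theorem bmrEmbed_of_neg (Y : ℕ → ℝ → ℝ) (i : Fin 4) {n : ℤ} (hn : n < 0) (t : ℝ) :
    bmrEmbed Y i n t = 0 := by
  simp [bmrEmbed, not_le.2 hn]

/-- **The embedded BMR solution is a global regular solution of the NS-scaled viscous dyadic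
lattice at `ε₀ = 1`** (viscosity `ν`, BMR viscosity `ν/4`): motion = BMR (1.1) at `β = 5/2` under
`X_{0,n} = 2^{5/2}Y_{n+1}`; the a-priori weight (4.5) from `weight_bound_oneMode`; `C¹` from the
continuity of the right-hand side.
[cite: BarbatoMorandinRomito2011, §1.1 (1.1), Thm. 1] [cite: Tao2016AveragedNS, §4 Lemma 4.1 (4.5)–(4.8), (4.11) and the viscous equation before Thm. 4.2] -/
theorem viscousGlobal_bmrEmbed {ν : ℝ} (hν : 0 < ν) {X₀ : Fin 4 → ℝ} (h0 : 0 ≤ X₀ 0)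
    (hz : ∀ i, i ≠ 0 → X₀ i = 0) {Y : ℕ → ℝ → ℝ}
    (hY : IsBMRWeakSolution (ν / 4) (5 / 2) (bmrDatum (X₀ 0)) Y) :
    ViscousGlobal 1 ν dyadicTable X₀ (bmrEmbed Y) := by
  have hβ : (5 / 2 : ℝ) ≠ 0 := by norm_num
  have hν4 : 0 < ν / 4 := by positivity
  have hx : ∀ n, 1 ≤ n → 0 ≤ bmrDatum (X₀ 0) n := fun n _ => bmrDatum_nonneg h0 n
  have hpos := hY.nonneg hβ hx
  have hc := bmrScale_pos
  refine ⟨?_, ?_, ?_, ?_, ?_⟩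
  · -- contDiffOn
    intro i n
    by_cases hi : i = 0
    · subst hi
      rcases lt_or_ge n 0 with hn | hn
      · have : bmrEmbed Y 0 n = fun _ => 0 := funext fun t => bmrEmbed_of_neg Y 0 hn t
        rw [this]; exact contDiffOn_const
      · lift n to ℕ using hn
        rw [bmrEmbed_zero_natCast_eq]
        exact contDiffOn_const.mul (hY.contDiffOn_one hβ n)
    · have : bmrEmbed Y i n = fun _ => 0 := funext fun t => bmrEmbed_of_ne Y hi n t
      rw [this]; exact contDiffOn_const
  · -- apriori
    intro T hT
    obtain ⟨M, hM0, hM⟩ := hY.weight_bound_oneMode hν4 (bmrDatum_nonneg h0 1)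
      (fun n hn => bmrDatum_of_two_le _ hn) (summable_bmrDatum_sq _) T
    refine ⟨bmrScale * (M + M), fun t ht i n => ?_⟩
    have hMM : 0 ≤ bmrScale * (M + M) := by positivity
    by_cases hi : i = 0
    · subst hi
      rcases lt_or_ge n 0 with hn | hn
      · rw [bmrEmbed_of_neg Y 0 hn, abs_zero, mul_zero]; exact hMM
      · lift n to ℕ using hn
        rw [bmrEmbed_zero_natCast, Int.cast_natCast]
        obtain ⟨hb1, hb2⟩ := hM t ht (n + 1) (by omega)
        have hYn := hpos (n + 1) (by omega) t ht.1
        have hw : (1 + 1 : ℝ) ^ ((10 : ℝ) * n) = (2 : ℝ) ^ (10 * n) := by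
          rw [show (10 : ℝ) * n = ((10 * n : ℕ) : ℝ) by push_cast; ring, Real.rpow_natCast]
          norm_num
        rw [hw, abs_of_nonneg (mul_nonneg hc.le hYn)]
        have h3 : (2 : ℝ) ^ (10 * n) * Y (n + 1) t ≤ M := by
          refine le_trans ?_ hb2
          exact mul_le_mul_of_nonneg_right (pow_le_pow_right₀ (by norm_num) (by omega)) hYn
        nlinarith
    · rw [bmrEmbed_of_ne Y hi, abs_zero, mul_zero]; exact hMM
  · -- init
    intro i n
    by_cases hi : i = 0
    · subst hi
      rcases lt_or_ge n 0 with hn | hn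
      · rw [bmrEmbed_of_neg Y 0 hn, if_neg hn.ne]
      · lift n to ℕ using hn
        rw [bmrEmbed_zero_natCast, hY.1 (n + 1) (by omega)]
        rcases Nat.eq_zero_or_pos n with rfl | hn'
        · simp [bmrDatum, mul_div_cancel₀ _ hc.ne']
        · rw [bmrDatum_of_two_le _ (by omega), mul_zero, if_neg (by exact_mod_cast hn'.ne')]
    · rw [bmrEmbed_of_ne Y hi]
      split_ifs with hn
      · exact (hz i hi).symm
      · rfl
  · -- motion
    intro i n t ht
    by_cases hi : i = 0
    · subst hi
      rcases lt_or_ge n 0 with hn | hn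
      · have hfun : bmrEmbed Y 0 n = fun _ => 0 := funext fun t => bmrEmbed_of_neg Y 0 hn t
        rw [quadTerm_dyadicTable_zero, hfun, bmrEmbed_of_neg Y 0 (by omega : n - 1 < 0)]
        simp
      · lift n to ℕ using hn
        rw [quadTerm_dyadicTable_zero, bmrEmbed_zero_natCast_eq,
          ((hY.2 (n + 1) (by omega) t ht).const_mul bmrScale).derivWithin
            (uniqueDiffOn_Ici 0 t ht)]
        rw [show (n : ℤ) + 1 = ((n + 1 : ℕ) : ℤ) by push_cast; ring, bmrEmbed_zero_natCast,
          Int.cast_natCast]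
        rcases Nat.eq_zero_or_pos n with rfl | hn'
        · -- shell 0 = BMR mode 1
          rw [bmrRHS_one hβ, bmrEmbed_of_neg Y 0 (by norm_num : (((0 : ℕ) : ℤ)) - 1 < 0)]
          have hL : bmrLambda 1 = 2 := by rw [bmrLambda_of_ne_zero one_ne_zero, pow_one]
          rw [hL]
          simp only [Nat.cast_zero, mul_zero, zero_div, Real.rpow_zero, zero_pow two_ne_zero,
            mul_one]
          rw [show (2 : ℝ) ^ ((5 / 2 : ℝ)) = bmrScale from rfl]
          ring
        · -- shell n = j + 1 = BMR mode j + 2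
          obtain ⟨j, rfl⟩ : ∃ j, n = j + 1 := ⟨n - 1, by omega⟩
          rw [show ((j + 1 : ℕ) : ℤ) - 1 = ((j : ℕ) : ℤ) by push_cast; ring, bmrEmbed_zero_natCast,
            bmrRHS_succ]
          have hL1 : bmrLambda (j + 1) = 2 ^ (j + 1) := bmrLambda_of_ne_zero (by omega)
          have hL2 : bmrLambda (j + 1 + 1) = 2 ^ (j + 2) := bmrLambda_of_ne_zero (by omega)
          rw [hL1, hL2, two_pow_rpow, two_pow_rpow]
          -- normalise all real powers of two to `bmrScale` and `p = 2^{5 j/2}`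
          have e1 : (2 : ℝ) ^ (((j + 1 : ℕ) : ℝ) * (5 / 2 : ℝ)) =
              bmrScale * (2 : ℝ) ^ ((5 : ℝ) * j / 2) := by
            rw [bmrScale, ← Real.rpow_add two_pos]; push_cast; ring_nf
          have e2 : (2 : ℝ) ^ (((j + 2 : ℕ) : ℝ) * (5 / 2 : ℝ)) =
              bmrScale * bmrScale * (2 : ℝ) ^ ((5 : ℝ) * j / 2) := by
            rw [bmrScale, ← Real.rpow_add two_pos, ← Real.rpow_add two_pos]; push_cast; ring_nf
          have e3 : (1 + 1 : ℝ) ^ ((5 : ℝ) * (((j + 1 : ℕ) : ℝ) - 1) / 2) =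
              (2 : ℝ) ^ ((5 : ℝ) * j / 2) := by
            push_cast; norm_num
          have e4 : (1 + 1 : ℝ) ^ ((5 : ℝ) * ((j + 1 : ℕ) : ℝ) / 2) =
              bmrScale * (2 : ℝ) ^ ((5 : ℝ) * j / 2) := by
            rw [bmrScale, ← Real.rpow_add two_pos]; push_cast; norm_num; ring_nf
          have e5 : (1 + 1 : ℝ) ^ ((2 : ℝ) * ((j + 1 : ℕ) : ℝ)) = (2 : ℝ) ^ (2 * (j + 1)) := by
            rw [show (1 + 1 : ℝ) = 2 by norm_num,
              show (2 : ℝ) * ((j + 1 : ℕ) : ℝ) = ((2 * (j + 1) : ℕ) : ℝ) by push_cast; ring,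
              Real.rpow_natCast]
          rw [e1, e2, e3, e4, e5]
          ring
    · have hfun : bmrEmbed Y i n = fun _ => 0 := funext fun t => bmrEmbed_of_ne Y hi n t
      rw [quadTerm_dyadicTable_of_ne _ _ hi, hfun]
      simp
  · -- noLow
    intro i n t hn _
    exact bmrEmbed_of_neg Y i hn t

/-- **The viscous dyadic member at `ε₀ = 1` is globally regular**: for every viscosity `ν > 0`
and every one-shell datum supported on component `0` with `X₀ 0 ≥ 0`, the NS-scaled viscous
lattice of `dyadicTable` at `ε₀ = 1` (base `2`, per-shell gain `2^{5/2}`: the Katz–Pavlović / BMR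
model at `β = 5/2`) has a global regular solution — Barbato–Morandin–Romito's Theorem 1, proved
in the tree (`BarbatoMorandinRomito2011_thm1_holds`), transported by `viscousGlobal_bmrEmbed`.
[cite: BarbatoMorandinRomito2011, §1.1 Thm. 1] [cite: Tao2016AveragedNS, §1.2 p. 9] -/
theorem exists_viscousGlobal_one_dyadicTable {ν : ℝ} (hν : 0 < ν) {X₀ : Fin 4 → ℝ}
    (h0 : 0 ≤ X₀ 0) (hz : ∀ i, i ≠ 0 → X₀ i = 0) :
    ∃ X : Fin 4 → ℤ → ℝ → ℝ, ViscousGlobal 1 ν dyadicTable X₀ X := by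
  obtain ⟨Y, hY, -⟩ := BarbatoMorandinRomito2011_thm1_holds (ν / 4) (5 / 2) (by positivity)
    (by norm_num) le_rfl (bmrDatum (X₀ 0)) (fun n _ => bmrDatum_nonneg h0 n)
    (summable_bmrDatum_sq _)
  exact ⟨bmrEmbed Y, viscousGlobal_bmrEmbed hν h0 hz hY⟩

/-- **Every defect level is realised at `ε₀ = 1` on the dyadic member**: for `κ > 0` and a
one-shell datum on component `0` with `X₀ 0 ≥ 0`, `HasGlobal 1 dyadicTable κ κ 0 X₀` (take the
viscous solution with `ν = κ/√2`, a `(κ, 0)`-pseudo-solution by `hasGlobal_of_viscousGlobal`).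
[cite: Tao2016AveragedNS, §4 Lemma 4.1 and the remark after (4.11)] [cite: BarbatoMorandinRomito2011, §1.1 Thm. 1] -/
theorem hasGlobal_one_dyadicTable {κ : ℝ} (hκ : 0 < κ) {X₀ : Fin 4 → ℝ} (h0 : 0 ≤ X₀ 0)
    (hz : ∀ i, i ≠ 0 → X₀ i = 0) : HasGlobal 1 dyadicTable κ κ 0 X₀ := by
  have h2 : 0 < Real.sqrt 2 := Real.sqrt_pos.2 two_pos
  obtain ⟨X, hX⟩ := exists_viscousGlobal_one_dyadicTable (div_pos hκ h2) h0 hz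
  have hG := hasGlobal_of_viscousGlobal one_pos (div_pos hκ h2).le hX
  rw [div_mul_cancel₀ κ h2.ne'] at hG
  exact hasGlobal_mono zero_le_one hG le_rfl hκ.le

/-- **Theorem 4.2-level blow-up fails for the dyadic member at `ε₀ = 1`** (non-negative one-shell
datum on component `0`): `¬ NoGlobalCascade 1 dyadicTable X₀` — by the κ-normal form
`noGlobalCascade_iff_kappa` and `hasGlobal_one_dyadicTable`.  This is the formal content of
"for the values `λ = 2^{1/α}`, `α = 2/5`, global regularity was established in [bmr] (for
non-negative initial data)", which rules out the dyadic analogue of Theorem 1.5; it says nothing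
about small `ε₀` (the regime of `Target`) or about other tables.
[cite: Tao2016AveragedNS, §1.2 p. 9 and §4 Thm. 4.2] [cite: BarbatoMorandinRomito2011, §1.1 Thm. 1] -/
theorem not_noGlobalCascade_one_dyadicTable {X₀ : Fin 4 → ℝ} (h0 : 0 ≤ X₀ 0)
    (hz : ∀ i, i ≠ 0 → X₀ i = 0) : ¬ NoGlobalCascade 1 dyadicTable X₀ := fun h => by
  obtain ⟨κ, hκ, hno⟩ := (noGlobalCascade_iff_kappa one_pos).1 h
  exact hno (hasGlobal_one_dyadicTable hκ h0 hz)

end ViscousDyadic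

end TaoCascade

end Literature.Analysis.FluidPDE

end
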